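import Mathlib.Data.Finset.Lattice.Fold
import Literature.MathematicalPhysics.QuantumFieldTheory.Volkov2024.SamplingDensityParameters
import HarnessLib

/-!
# Volkov 2024: the sampling exponent Deg₀(s) of PRD 110, 036001 §IV.B.3 is bounded below by construction — D_F(s) > C_Add(s) + C_Sat(s) > 0 in every column of TABLE V, and the «big-set» branch is ≥ min(C_BigZ, C_BigF) = C_BigF > 0 — so §IV.A's requirement «Deg₀(s) are arbitrary positive real numbers» is met by the printed formula with the printed constants, uniformly in the graph, the forest set and the line set

independent recomputation; certified where stated, statistical where stated; no new-physics claim.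

CITATION HEADER (venture `QEDPrecision`, cell `pub-qed`, track TROPICAL seat V3b = `pub-qed-trop-v3-lit-2` gen 6; VALUE-FREE: the printed
sampler constants and the SHAPE of the printed formula only — no integral, no Monte-Carlo value, nothing per graph or per Set V family).
The 2024 counterpart of `Volkov2017.SamplingDegreePositivity` (seat V3a: `deg17_pos`, `deg18_printed_pos`); serves
`tropical/view/V3-VOLKOV-DEGREES.md` §B B.6.4 / B.10 (1) / B.17 clause 5 («E-dens > 0 everywhere for EVERY word — positivity of Volkov's
exponents is automatic (normalisability)»), which this file makes a kernel fact for the pure g₀ density of 2024.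

Source. [Volkov2024] S. Volkov, "Calculation of the total 10th order QED contribution to the electron magnetic moment", Phys. Rev. D 110,
036001 (2024) = arXiv:2404.00649v2 (LaTeX e-print `amm5_a1_all.tex` held by the cell; typed verbatim in `Volkov2024.SamplingDensityParameters`,
whose `mu`, `tau`, `cAdd`, `cSat`, `tableV`, `tau_sub_bounds`, `tableV_CaCs_pos` are the objects used here):
* §IV.A (PDF p.9–10; tex l.462–470): "g₀(z) = C × ∏_{l=2}^{K} (z_{j_l}/z_{j_{l−1}})^{Deg₀({j_l, j_{l+1}, …, j_K})} / (z₁z₂…z_K) … Deg₀(s) are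
  arbitrary positive real numbers defined for any set s ⊆ {1,2,…,K} (except the empty and full sets); C is a constant such that
  ∫ g₀(z) δ(z₁+…+z_K−1) dz₁…dz_K = 1." — positivity of every Deg₀(s) is what makes g₀ normalisable sector by sector.
* §IV.B.3 "The formula" (PDF p.21; tex l.1150–1177): "Deg₀(s) = C_BigZ + (C_BigF − C_BigZ)·|Ph(s)|/|Ph(E[G])|, if Lept(E[G]) ⊆ s, and there
  exists F ∈ 𝔉_max[G] such that ω̃_{G′,F}(s) ≥ 0 for all G′ ∈ F; min_{F∈𝔉_max[G]} D_F(s) otherwise, where D_F(s) = τ(−Σ_{G′∈F} ω̃′_{G′,F}(s),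
  C_Add(s), C_Sat(s)), … τ(x, C_a, C_s) = ½(C_a + C_s) μ((x − C_s)/(C_a + C_s)), μ(t) = 2 + t + √(t² + 0.25). … μ(t) is a smooth
  approximation for 2 + max(0, 2t); the function τ(x, C_a, C_s) is a smooth approximation for max(x, C_s) + C_a."
* TABLE V (PDF p.19; tex l.1033–1049): C_Add(s) = 0.199 / −0.122 / 0 / 0.187 and C_Sat(s) = 0.46 / 0.716 / 0.785 / 0.684 in the four columns
  (cyclo-complete: on path, on loop; not cyclo-complete: on path, on loop); C_BigZ = 0.695 / 1.079 and C_BigF = 0.285 / 0.38 in the two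
  cyclo-complete columns, "…" in the other two — consistently with the formula: the big-set branch requires Lept(E[G]) ⊆ s, and such an s is
  cyclo-complete by the definition of §IV.B.2 ("(Lept(E[G]) ∖ LPath[G]) ⊆ s").

What the kernel certifies (elementary order reasoning on the printed formula; `norm_num` / `fin_cases` on the printed constants):
* `tau_gt_sum`: τ(x, C_a, C_s) > C_a + C_s for every real x whenever C_a + C_s > 0 (from `tau_sub_bounds`: τ > max(x, C_s) + C_a ≥ C_s + C_a);
  `tau_gt_arg_add`: τ(x, C_a, C_s) > x + C_a likewise.
* `DF_gt_col`, `DF_pos`: in every column j of TABLE V and for EVERY real argument x (in the paper x = −Σ_{G′∈F} ω̃′_{G′,F}(s) ≥ 0, but no sign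
  is needed), D_F = τ(x, C_Add, C_Sat) > C_Add + C_Sat ∈ {0.659, 0.594, 0.785, 0.871} > 0; `DF_min_pos`: hence min over any nonempty
  finite family of forests is > 0 (the «otherwise» branch of Deg₀).
* `bigBranch`, `min_le_bigBranch`: C_BigZ + (C_BigF − C_BigZ)·r lies above min(C_BigZ, C_BigF) for every ratio 0 ≤ r ≤ 1 (r = |Ph(s)|/|Ph(E[G])|);
  `cBigZ`, `cBigF` (the two printed columns), `cBig_rows` (= rows 6–7 of `tableV`), `cBigF_lt_cBigZ` (the 2024 table FLIPS the 2018 order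
  C_bigZ = 0.256 < C_bigF = 0.839, cf. `topcase_monotonicity_flipped`), `bigBranch_printed_ge` / `bigBranch_printed_pos`: the big-set branch is
  ≥ C_BigF = 0.285 (on path) / 0.38 (on loop) > 0.
* `deg0_2024_branches_pos`: both branches positive in every printed column — the as-printed counterpart of "Deg₀(s) are arbitrary positive
  real numbers". NOT claimed: anything about the stabiliser mixture (its floors are `SamplingDensityParameters.deg24`, `degMin24`), about the
  variance of the weighted estimator (PRD 110 §IV.B.1: "we can not guarantee this … examples of high order are known that result in an infinite
  [second-moment] integral"), or about any particular graph.
-/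

namespace Literature.MathematicalPhysics.QuantumFieldTheory.Volkov2024

/-! ## τ is bounded below by C_a + C_s and by x + C_a -/

/-- τ(x, C_a, C_s) > C_a + C_s for every real x, as soon as C_a + C_s > 0 (τ exceeds max(x, C_s) + C_a ≥ C_s + C_a).
[cite: Volkov2024, §IV.B.3 "The formula" (PDF p.21)] -/
theorem tau_gt_sum (x ca cs : ℝ) (h : 0 < ca + cs) : ca + cs < tau x ca cs := by
  have h1 := (tau_sub_bounds x ca cs h).1
  have h2 : cs ≤ max x cs := le_max_right _ _
  linarith

/-- τ(x, C_a, C_s) > x + C_a for every real x, as soon as C_a + C_s > 0. [cite: Volkov2024, §IV.B.3 "The formula" (PDF p.21)] -/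
theorem tau_gt_arg_add (x ca cs : ℝ) (h : 0 < ca + cs) : x + ca < tau x ca cs := by
  have h1 := (tau_sub_bounds x ca cs h).1
  have h2 : x ≤ max x cs := le_max_left _ _
  linarith

/-- τ(x, C_a, C_s) > 0 for every real x whenever C_a + C_s > 0. [cite: Volkov2024, §IV.B.3] -/
theorem tau_pos (x ca cs : ℝ) (h : 0 < ca + cs) : 0 < tau x ca cs :=
  lt_trans h (tau_gt_sum x ca cs h)

/-! ## The D_F branch: D_F(s) = τ(−Σ ω̃′, C_Add(s), C_Sat(s)) > C_Add(s) + C_Sat(s) > 0 in every column of TABLE V -/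

/-- In column `j` of TABLE V, D_F = τ(x, C_Add, C_Sat) > C_Add + C_Sat for EVERY real argument x (no sign hypothesis on x = −Σ ω̃′ is needed).
[cite: Volkov2024, §IV.B.3 "The formula" + Table V (PDF p.19, p.21)] -/
theorem DF_gt_col (j : Fin 4) (x : ℝ) : ((cAdd j : ℝ) + (cSat j : ℝ)) < tau x (cAdd j) (cSat j) := by
  have h : (0 : ℝ) < (cAdd j : ℝ) + (cSat j : ℝ) := by exact_mod_cast tableV_CaCs_pos j
  exact tau_gt_sum x _ _ h

/-- In every column of TABLE V and for every real argument, D_F > 0 (indeed > 0.594, the smallest C_Add + C_Sat).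
[cite: Volkov2024, §IV.B.3 + Table V] -/
theorem DF_pos (j : Fin 4) (x : ℝ) : 0 < tau x (cAdd j) (cSat j) := by
  have h : (0 : ℝ) < (cAdd j : ℝ) + (cSat j : ℝ) := by exact_mod_cast tableV_CaCs_pos j
  exact lt_trans h (DF_gt_col j x)

/-- The smallest printed C_Add + C_Sat is 0.594 (cyclo-complete / on-loop column): a uniform lower bound for D_F in every column.
[cite: Volkov2024, Table V] -/
theorem cAdd_cSat_ge : ∀ j : Fin 4, (0.594 : ℚ) ≤ cAdd j + cSat j := by
  intro j; fin_cases j <;> simp only [cAdd, cSat] <;> norm_num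

/-- Uniform version: D_F > 0.594 in every column, for every real argument. [cite: Volkov2024, §IV.B.3 + Table V] -/
theorem DF_gt_uniform (j : Fin 4) (x : ℝ) : (0.594 : ℝ) < tau x (cAdd j) (cSat j) := by
  have h1 := DF_gt_col j x
  have h2 : ((0.594 : ℚ) : ℝ) ≤ ((cAdd j + cSat j : ℚ) : ℝ) := by exact_mod_cast cAdd_cSat_ge j
  push_cast at h2
  have h3 : ((0.594 : ℚ) : ℝ) = (0.594 : ℝ) := by norm_num
  linarith

/-- The «otherwise» branch of Deg₀ is a minimum of D_F over the (nonempty, finite) set of maximal forests: a minimum of positive numbers is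
positive. Stated for an arbitrary nonempty `Finset` of forests `𝓕` and an arbitrary argument map `x : forest ↦ −Σ ω̃′`.
[cite: Volkov2024, §IV.B.3 "The formula"] -/
theorem DF_min_pos {ι : Type*} (𝓕 : Finset ι) (h𝓕 : 𝓕.Nonempty) (j : Fin 4) (x : ι → ℝ) :
    0 < 𝓕.inf' h𝓕 (fun F => tau (x F) (cAdd j) (cSat j)) := by
  rw [Finset.lt_inf'_iff]
  intro F _
  exact DF_pos j (x F)

/-! ## The big-set branch: C_BigZ + (C_BigF − C_BigZ)·|Ph(s)|/|Ph(E[G])| ≥ min(C_BigZ, C_BigF) -/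

/-- The big-set branch of Deg₀ as a function of the photon fraction r = |Ph(s)|/|Ph(E[G])| ∈ [0, 1].
[cite: Volkov2024, §IV.B.3 "The formula"] -/
def bigBranch (z f r : ℝ) : ℝ := z + (f - z) * r

/-- At r = 0 the branch is C_BigZ, at r = 1 it is C_BigF (hence the names: Z = zero photons of s, F = full photon set). [cite: Volkov2024, §IV.B.3] -/
theorem bigBranch_endpoints (z f : ℝ) : bigBranch z f 0 = z ∧ bigBranch z f 1 = f := by
  unfold bigBranch; constructor <;> ring

/-- For 0 ≤ r ≤ 1 the branch is a convex combination of C_BigZ and C_BigF, hence ≥ their minimum. [cite: Volkov2024, §IV.B.3] -/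
theorem min_le_bigBranch (z f r : ℝ) (h0 : 0 ≤ r) (h1 : r ≤ 1) : min z f ≤ bigBranch z f r := by
  unfold bigBranch
  rcases le_total z f with hzf | hfz
  · rw [min_eq_left hzf]
    nlinarith
  · rw [min_eq_right hfz]
    nlinarith

/-- C_BigZ by cyclo-complete column (0 = on path, 1 = on loop): 0.695 / 1.079. [cite: Volkov2024, Table V (PDF p.19)] -/
def cBigZ : Fin 2 → ℚ
  | 0 => 0.695
  | 1 => 1.079

/-- C_BigF by cyclo-complete column (0 = on path, 1 = on loop): 0.285 / 0.38. [cite: Volkov2024, Table V (PDF p.19)] -/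
def cBigF : Fin 2 → ℚ
  | 0 => 0.285
  | 1 => 0.38

/-- `cBigZ`, `cBigF` are rows 6–7 of `tableV` (printed only in the two cyclo-complete columns; "…" = `none` elsewhere). [cite: Volkov2024, Table V] -/
theorem cBig_rows :
    (((tableV.map fun r => (r.ccPath, r.ccLoop, r.ncPath, r.ncLoop)).drop 5).take 2) =
      [(some (cBigZ 0), some (cBigZ 1), none, none), (some (cBigF 0), some (cBigF 1), none, none)] := by
  rfl

/-- The 2024 table FLIPS the 2018 order: C_BigF < C_BigZ in both printed columns (2018: C_bigZ = 0.256 < C_bigF = 0.839, `K18`), so the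
big-set branch DEcreases with the photon fraction and its minimum is C_BigF (the 2018 values are PRD 98's eq. (15), typed as `K18`). [cite: Volkov2024, Table V] -/
theorem cBigF_lt_cBigZ : ∀ j : Fin 2, cBigF j < cBigZ j := by
  intro j; fin_cases j <;> simp only [cBigF, cBigZ] <;> norm_num

/-- With the printed constants the big-set branch is ≥ C_BigF (0.285 on path, 0.38 on loop) for every photon fraction 0 ≤ r ≤ 1.
[cite: Volkov2024, §IV.B.3 + Table V] -/
theorem bigBranch_printed_ge (j : Fin 2) (r : ℝ) (h0 : 0 ≤ r) (h1 : r ≤ 1) :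
    (cBigF j : ℝ) ≤ bigBranch (cBigZ j) (cBigF j) r := by
  have hmin := min_le_bigBranch (cBigZ j : ℝ) (cBigF j) r h0 h1
  have hlt : (cBigF j : ℝ) < (cBigZ j : ℝ) := by exact_mod_cast cBigF_lt_cBigZ j
  rw [min_eq_right hlt.le] at hmin
  exact hmin

/-- C_BigF > 0 in both printed columns. [cite: Volkov2024, Table V] -/
theorem cBigF_pos : ∀ j : Fin 2, 0 < cBigF j := by
  intro j; fin_cases j <;> simp only [cBigF] <;> norm_num

/-- Hence the big-set branch of Deg₀ is > 0 for every photon fraction 0 ≤ r ≤ 1, in both printed columns. [cite: Volkov2024, §IV.B.3 + Table V] -/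
theorem bigBranch_printed_pos (j : Fin 2) (r : ℝ) (h0 : 0 ≤ r) (h1 : r ≤ 1) :
    0 < bigBranch (cBigZ j) (cBigF j) r := by
  have h := bigBranch_printed_ge j r h0 h1
  have hp : (0 : ℝ) < (cBigF j : ℝ) := by exact_mod_cast cBigF_pos j
  linarith

/-! ## Both branches together -/

/-- BOTH branches of the printed Deg₀ are positive with the printed TABLE V: the big-set branch (photon fraction 0 ≤ r ≤ 1, either
cyclo-complete column) is ≥ C_BigF > 0, and the D_F branch (any column, any real argument, min over any nonempty finite forest family) is
> C_Add + C_Sat ≥ 0.594 > 0 — the as-printed content of §IV.A's requirement "Deg₀(s) are arbitrary positive real numbers" for the formula of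
§IV.B.3. Nothing is claimed about the stabiliser mixture or about the variance of the weighted estimator.
[cite: Volkov2024, §IV.A (PDF p.9–10), §IV.B.3 (PDF p.21), Table V (PDF p.19)] -/
theorem deg0_2024_branches_pos :
    (∀ (j : Fin 2) (r : ℝ), 0 ≤ r → r ≤ 1 → 0 < bigBranch (cBigZ j) (cBigF j) r) ∧
    (∀ {ι : Type} (𝓕 : Finset ι) (h𝓕 : 𝓕.Nonempty) (j : Fin 4) (x : ι → ℝ),
      0 < 𝓕.inf' h𝓕 (fun F => tau (x F) (cAdd j) (cSat j))) :=
  ⟨fun j r h0 h1 => bigBranch_printed_pos j r h0 h1, fun 𝓕 h𝓕 j x => DF_min_pos 𝓕 h𝓕 j x⟩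

/-- The uniform numeric floor of the pure 2024 g₀ exponent implied by the two branches: min(C_BigF(on path), 0.594) = 0.285 — every
Deg₀(s) the printed formula can return exceeds 0.285 (on-path graphs: big-set ≥ 0.285, D_F > 0.659; on-loop graphs: ≥ 0.38 / > 0.594).
[cite: Volkov2024, §IV.B.3 + Table V] -/
theorem deg0_2024_floor : min (cBigF 0) (0.594 : ℚ) = 0.285 ∧ cBigF 0 ≤ cBigF 1 ∧ (0.594 : ℚ) ≤ cAdd 0 + cSat 0 := by
  refine ⟨?_, ?_, ?_⟩
  · simp only [cBigF]; norm_num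
  · simp only [cBigF]; norm_num
  · simp only [cAdd, cSat]; norm_num


end Literature.MathematicalPhysics.QuantumFieldTheory.Volkov2024
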